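import Summits.CriticalPhenomena.PercolationContinuityZ3.Theorems.PercNearOneGluingNoHeavyLowerTailSahiPair43Lanes
import Summits.CriticalPhenomena.PercolationContinuityZ3.Theorems.PercNearOneGluingNoHeavyLowerTailSahiPair43LinkScalar

/-!
# `NoHeavyLowerTail` (crux stmt-CriticalPhenomena-4575), Sahi programme: the cell `(4,3)` — **link, packed profile**: lane `i` of
# `packedProfile` at the code of `y` is `BIAS + yProfile A_i B_i y`

Support file (Sahi cell `prim-sahi`, seat `prim-sahi-typer` gen 31–32; `--supports stmt-CriticalPhenomena-4575`).  Pure proofs plus the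
bookkeeping definition `profN` (the profile lane function); no `sorry`, standard axioms.

With `pa = ofLanes nb fA`, `pb = ofLanes nb fB` (masks `fA i, fB i < 2^81`) and `one = ones nb`:
* `alpha_eq`: `(pa >>> x) &&& one` is the lane vector of the bits `x` of the `fA i` (`extract_eq`);
* `foldl_lanes`: a fold of lane-vector additions is the lane vector of the folded lane functions;
* **`packedProfile_getD`**: entry `y < 81` of `packedProfile one pa pb` is `ofLanes nb (profN fA fB y)`, with every lane `< 2^13`;
* **`profN_eq`**: if `fA i, fB i` represent `A, B` then `(profN fA fB (enc p) i : ℤ) = BIAS + yProfile A B p`. [this work]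
-/

namespace Summit.CriticalPhenomena.PercolationContinuityZ3.Theorems.SahiGridPattern.Pair43

open Finset SahiGrid3 SahiGridPattern
open scoped BigOperators

/-! ### Generic: folds of lane vectors -/

/-- A fold adding lane vectors is the lane vector of the summed lane functions. [this work] -/
theorem foldl_lanes {β : Type} (nb : ℕ) (l : List β) (F : β → ℕ) (φ : β → ℕ → ℕ) (hF : ∀ b ∈ l, F b = ofLanes nb (φ b))
    (s : ℕ) (σ : ℕ → ℕ) (hs : s = ofLanes nb σ) :
    l.foldl (fun acc b => acc + F b) s = ofLanes nb (fun i => σ i + ((l.map fun b => φ b i).sum)) := by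
  induction l generalizing s σ with
  | nil => rw [List.foldl_nil, hs]; exact ofLanes_congr fun i _ => by simp
  | cons b rest ih =>
    rw [List.foldl_cons]
    have hb : F b = ofLanes nb (φ b) := hF b (by simp)
    rw [ih (fun b' hb' => hF b' (by simp [hb'])) (s + F b) (fun i => σ i + φ b i) (by rw [hs, hb, ofLanes_add])]
    exact ofLanes_congr fun i _ => by simp [add_assoc]

/-- A list sum of values each `≤ c` is at most `length · c`. [this work] -/
theorem list_sum_le {β : Type} (l : List β) (g : β → ℕ) (c : ℕ) (h : ∀ b ∈ l, g b ≤ c) : (l.map g).sum ≤ l.length * c := by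
  induction l with
  | nil => simp
  | cons b rest ih =>
    simp only [List.map_cons, List.sum_cons, List.length_cons]
    have h1 := h b (by simp)
    have h2 := ih fun b' hb' => h b' (by simp [hb'])
    rw [Nat.succ_mul]; omega

/-- The table `tdL[y]` has at most 81 entries. [this work] -/
theorem tdL_length_le (y : ℕ) :
    (((List.range 81).filter fun q => tdC q y).map fun q => (q, thirdC q y)).length ≤ 81 := by
  rw [List.length_map]
  exact (List.length_filter_le _ _).trans (by simp)

/-! ### The profile lane function -/

/-- Bit of a mask as `0/1`. [this work] -/
def bt (m x : ℕ) : ℕ := bit01 (m.testBit x)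

/-- `bt ≤ 1`. [this work] -/
theorem bt_le (m x : ℕ) : bt m x ≤ 1 := bit01_le _

/-- The list underlying `tdL[y]`. [this work] -/
def tdList (y : ℕ) : List (ℕ × ℕ) := ((List.range 81).filter fun q => tdC q y).map fun q => (q, thirdC q y)

/-- `tdL[y]` as a list. [this work] -/
theorem tdL_getD_nat {y : ℕ} (hy : y < 81) : tdL.getD y #[] = (tdList y).toArray := by
  unfold tdL tdList; rw [SahiSlot34.getD_ofFn _ _ hy]

/-- **The profile lane function** (in `ℕ`, offset by `BIAS`): lane `i` of entry `y` of `packedProfile`. [this work] -/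
def profN (fA fB : ℕ → ℕ) (y i : ℕ) : ℕ :=
  BIAS + bt (fA i) y * bt (fB i) y * 32 + ((tdList y).map fun qt => bt (fB i) qt.1 * bt (fA i) qt.2).sum
    - (bt (fB i) y * ((tdList y).map fun qt => bt (fA i) qt.1).sum + bt (fA i) y * ((tdList y).map fun qt => bt (fB i) qt.1).sum
        + ((tdList y).map fun qt => bt (fA i) qt.1 * bt (fB i) qt.1).sum)

/-- The three negative sums are each `≤ 81`, so the subtraction in `profN` never truncates and `profN < 2^13`. [this work] -/
theorem profN_parts_le (fA fB : ℕ → ℕ) (y i : ℕ) :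
    bt (fB i) y * ((tdList y).map fun qt => bt (fA i) qt.1).sum + bt (fA i) y * ((tdList y).map fun qt => bt (fB i) qt.1).sum
        + ((tdList y).map fun qt => bt (fA i) qt.1 * bt (fB i) qt.1).sum ≤ 243 ∧
      ((tdList y).map fun qt => bt (fB i) qt.1 * bt (fA i) qt.2).sum ≤ 81 := by
  have hl : (tdList y).length ≤ 81 := tdL_length_le y
  have s1 : ((tdList y).map fun qt => bt (fA i) qt.1).sum ≤ 81 :=
    (list_sum_le _ _ 1 fun qt _ => bt_le _ _).trans (by omega)
  have s2 : ((tdList y).map fun qt => bt (fB i) qt.1).sum ≤ 81 :=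
    (list_sum_le _ _ 1 fun qt _ => bt_le _ _).trans (by omega)
  have s3 : ((tdList y).map fun qt => bt (fA i) qt.1 * bt (fB i) qt.1).sum ≤ 81 :=
    (list_sum_le _ _ 1 fun qt _ => by
      have := bt_le (fA i) qt.1; have := bt_le (fB i) qt.1; nlinarith).trans (by omega)
  have s4 : ((tdList y).map fun qt => bt (fB i) qt.1 * bt (fA i) qt.2).sum ≤ 81 :=
    (list_sum_le _ _ 1 fun qt _ => by
      have := bt_le (fB i) qt.1; have := bt_le (fA i) qt.2; nlinarith).trans (by omega)
  have hb1 := bt_le (fB i) y; have hb2 := bt_le (fA i) y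
  refine ⟨?_, s4⟩
  have e1 : bt (fB i) y * ((tdList y).map fun qt => bt (fA i) qt.1).sum ≤ 81 :=
    (Nat.mul_le_mul hb1 s1).trans (by norm_num)
  have e2 : bt (fA i) y * ((tdList y).map fun qt => bt (fB i) qt.1).sum ≤ 81 :=
    (Nat.mul_le_mul hb2 s2).trans (by norm_num)
  omega

/-- `profN < 2^13`. [this work] -/
theorem profN_lt (fA fB : ℕ → ℕ) (y i : ℕ) : profN fA fB y i < 2 ^ 13 := by
  have h := profN_parts_le fA fB y i
  have hb1 := bt_le (fA i) y; have hb2 := bt_le (fB i) y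
  have : bt (fA i) y * bt (fB i) y * 32 ≤ 32 := by nlinarith
  unfold profN BIAS
  omega

/-! ### `packedProfile` lane by lane -/

/-- `2^81 ≤ 2^LW`. [this work] -/
theorem pow81_le : (2 : ℕ) ^ 81 ≤ 2 ^ LW := Nat.pow_le_pow_right (by omega) (by decide)

/-- `2^13 ≤ 2^LW`. [this work] -/
theorem pow13_lt_LW : (2 : ℕ) ^ 13 < 2 ^ LW := Nat.pow_lt_pow_right (by omega) (by decide)

/-- `0/1` lanes are `< 2^13`. [this work] -/
theorem bt_lt13 (m x : ℕ) : bt m x < 2 ^ 13 := (Nat.lt_succ_of_le (bt_le m x)).trans_le (by norm_num)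

/-- AND of `0/1` lanes is the product. [this work] -/
theorem bt_and_bt (m x m' x' : ℕ) : bt m x &&& bt m' x' = bt m x * bt m' x' := by
  unfold bt bit01
  cases m.testBit x <;> cases m'.testBit x' <;> simp

/-- Expanding a `0/1` lane by `FMUL` and masking a small lane selects it. [this work] -/
theorem btFMUL_and (m x : ℕ) {v : ℕ} (hv : v < 2 ^ 13) : (bt m x * FMUL) &&& v = bt m x * v := by
  unfold bt bit01
  cases m.testBit x
  · simp
  · simp only [if_true, Nat.one_mul]
    rw [Nat.land_comm, FMUL_eq, Nat.and_two_pow_sub_one_eq_mod]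
    exact Nat.mod_eq_of_lt (hv.trans (Nat.pow_lt_pow_right (by omega) (by decide)))

/-- `bt * FMUL < 2^LW`. [this work] -/
theorem btFMUL_lt (m x : ℕ) : bt m x * FMUL < 2 ^ LW := by
  have h1 : bt m x * FMUL ≤ 1 * FMUL := Nat.mul_le_mul_right _ (bt_le m x)
  have h2 : FMUL < 2 ^ GB := by rw [FMUL_eq]; exact Nat.sub_lt Nat.one_le_two_pow Nat.one_pos
  have h3 : (2 : ℕ) ^ GB < 2 ^ LW := Nat.pow_lt_pow_right (by omega) (by decide)
  omega

/-- A fold adding lane vectors from `0`. [this work] -/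
theorem foldl_lanes0 {β : Type} (nb : ℕ) (l : List β) (F : β → ℕ) (φ : β → ℕ → ℕ) (hF : ∀ b ∈ l, F b = ofLanes nb (φ b)) :
    l.foldl (fun acc b => acc + F b) 0 = ofLanes nb (fun i => (l.map fun b => φ b i).sum) := by
  rw [foldl_lanes nb l F φ hF 0 (fun _ => 0) (by unfold ofLanes; simp)]
  exact ofLanes_congr fun i _ => by simp

/-- Codes in the table `tdList y` are `< 81`. [this work] -/
theorem tdList_lt {y : ℕ} : ∀ qt ∈ tdList y, qt.1 < 81 ∧ qt.2 < 81 := by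
  intro qt hqt
  unfold tdList at hqt
  rw [List.mem_map] at hqt
  obtain ⟨q, hq, rfl⟩ := hqt
  rw [List.mem_filter, List.mem_range] at hq
  refine ⟨hq.1, ?_⟩
  show thirdC q y < 81
  unfold thirdC; omega

section Packed

variable {nb : ℕ} {fA fB : ℕ → ℕ} (hA : ∀ i < nb, fA i < 2 ^ 81) (hB : ∀ i < nb, fB i < 2 ^ 81)
include hA hB

omit hB in
/-- The bit-`x` lane vector of the first masks. [this work] -/
theorem alpha_eq {x : ℕ} (hx : x < 81) :
    (ofLanes nb fA >>> x) &&& ones nb = ofLanes nb (fun i => bt (fA i) x) :=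
  extract_eq (fun i hi => (hA i hi).trans_le pow81_le) (hx.trans (by decide))

omit hA in
/-- The bit-`x` lane vector of the second masks. [this work] -/
theorem beta_eq {x : ℕ} (hx : x < 81) :
    (ofLanes nb fB >>> x) &&& ones nb = ofLanes nb (fun i => bt (fB i) x) :=
  extract_eq (fun i hi => (hB i hi).trans_le pow81_le) (hx.trans (by decide))

omit hB in
/-- The `α` table of `packedProfile`. [this work] -/
theorem alphaT_getD {q : ℕ} (hq : q < 81) :
    (Array.ofFn fun x : Fin 81 => (ofLanes nb fA >>> x.val) &&& ones nb).getD q 0 = ofLanes nb (fun i => bt (fA i) q) := by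
  rw [SahiSlot34.getD_ofFn _ _ hq]; exact alpha_eq hA hq

omit hA in
/-- The `β` table of `packedProfile`. [this work] -/
theorem betaT_getD {q : ℕ} (hq : q < 81) :
    (Array.ofFn fun x : Fin 81 => (ofLanes nb fB >>> x.val) &&& ones nb).getD q 0 = ofLanes nb (fun i => bt (fB i) q) := by
  rw [SahiSlot34.getD_ofFn _ _ hq]; exact beta_eq hB hq

/-- The `ω` table of `packedProfile`. [this work] -/
theorem omegaT_getD {q : ℕ} (hq : q < 81) :
    (Array.ofFn fun x : Fin 81 =>
        (Array.ofFn fun x : Fin 81 => (ofLanes nb fA >>> x.val) &&& ones nb).getD x 0 &&&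
          (Array.ofFn fun x : Fin 81 => (ofLanes nb fB >>> x.val) &&& ones nb).getD x 0).getD q 0 =
      ofLanes nb (fun i => bt (fA i) q * bt (fB i) q) := by
  rw [SahiSlot34.getD_ofFn _ _ hq]
  show (Array.ofFn fun x : Fin 81 => (ofLanes nb fA >>> x.val) &&& ones nb).getD q 0 &&&
      (Array.ofFn fun x : Fin 81 => (ofLanes nb fB >>> x.val) &&& ones nb).getD q 0 = _
  rw [alphaT_getD hA hq, betaT_getD hB hq,
    ofLanes_and (fun i _ => (bt_lt13 _ _).trans pow13_lt_LW) (fun i _ => (bt_lt13 _ _).trans pow13_lt_LW)]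
  exact ofLanes_congr fun i _ => bt_and_bt _ _ _ _

/-- **`packedProfile` lane by lane**: entry `y < 81` is the lane vector of `profN fA fB y`. [this work] -/
theorem packedProfile_getD {y : ℕ} (hy : y < 81) :
    (packedProfile (ones nb) (ofLanes nb fA) (ofLanes nb fB)).getD y 0 = ofLanes nb (profN fA fB y) := by
  unfold packedProfile
  simp only []
  rw [SahiSlot34.getD_ofFn _ _ hy]
  simp only []
  rw [tdL_getD_nat hy]
  simp only [List.foldl_toArray]
  -- the four folds
  have e1 := foldl_lanes0 nb (tdList y) _ (fun qt i => bt (fA i) qt.1) (fun qt hqt => alphaT_getD hA (tdList_lt qt hqt).1)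
  have e2 := foldl_lanes0 nb (tdList y) _ (fun qt i => bt (fB i) qt.1) (fun qt hqt => betaT_getD hB (tdList_lt qt hqt).1)
  have e3 := foldl_lanes0 nb (tdList y) _ (fun qt i => bt (fA i) qt.1 * bt (fB i) qt.1)
    (fun qt hqt => omegaT_getD hA hB (tdList_lt qt hqt).1)
  have e4 := foldl_lanes0 nb (tdList y)
    (fun qt => (Array.ofFn fun x : Fin 81 => (ofLanes nb fB >>> x.val) &&& ones nb).getD qt.1 0 &&&
      (Array.ofFn fun x : Fin 81 => (ofLanes nb fA >>> x.val) &&& ones nb).getD qt.2 0)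
    (fun qt i => bt (fB i) qt.1 * bt (fA i) qt.2)
    (fun qt hqt => by
      show (Array.ofFn fun x : Fin 81 => (ofLanes nb fB >>> x.val) &&& ones nb).getD qt.1 0 &&&
          (Array.ofFn fun x : Fin 81 => (ofLanes nb fA >>> x.val) &&& ones nb).getD qt.2 0 = _
      rw [betaT_getD hB (tdList_lt qt hqt).1, alphaT_getD hA (tdList_lt qt hqt).2,
        ofLanes_and (fun i _ => (bt_lt13 _ _).trans pow13_lt_LW) (fun i _ => (bt_lt13 _ _).trans pow13_lt_LW)]
      exact ofLanes_congr fun i _ => bt_and_bt _ _ _ _)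
  rw [e1, e2, e3, e4, omegaT_getD hA hB hy, alphaT_getD hA hy, betaT_getD hB hy, ones_eq]
  -- bounds on the small lanes
  have bnd := fun i => profN_parts_le fA fB y i
  have hsA : ∀ i, ((tdList y).map fun qt => bt (fA i) qt.1).sum ≤ 81 := fun i =>
    (list_sum_le _ _ 1 fun qt _ => bt_le _ _).trans (by have := tdL_length_le y; unfold tdList; omega)
  have hsB : ∀ i, ((tdList y).map fun qt => bt (fB i) qt.1).sum ≤ 81 := fun i =>
    (list_sum_le _ _ 1 fun qt _ => bt_le _ _).trans (by have := tdL_length_le y; unfold tdList; omega)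
  have hsW : ∀ i, ((tdList y).map fun qt => bt (fA i) qt.1 * bt (fB i) qt.1).sum ≤ 81 := fun i =>
    (list_sum_le _ _ 1 fun qt _ => by have := bt_le (fA i) qt.1; have := bt_le (fB i) qt.1; nlinarith).trans
      (by have := tdL_length_le y; unfold tdList; omega)
  -- positive part
  rw [ofLanes_mul, ofLanes_shiftLeft, ofLanes_add, ofLanes_add]
  -- negative part
  rw [ofLanes_mul, ofLanes_mul,
    ofLanes_and (fun i _ => btFMUL_lt _ _) (fun i _ => (lt_of_le_of_lt (hsA i) (by norm_num) : _ < 2 ^ 13).trans pow13_lt_LW),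
    ofLanes_and (fun i _ => btFMUL_lt _ _) (fun i _ => (lt_of_le_of_lt (hsB i) (by norm_num) : _ < 2 ^ 13).trans pow13_lt_LW),
    ofLanes_add, ofLanes_add]
  rw [ofLanes_sub (fun i _ => ?_)]
  · refine ofLanes_congr fun i _ => ?_
    rw [btFMUL_and _ _ (lt_of_le_of_lt (hsA i) (by norm_num)), btFMUL_and _ _ (lt_of_le_of_lt (hsB i) (by norm_num))]
    unfold profN BIAS
    simp only [Nat.one_mul]
    ring_nf
  · rw [btFMUL_and _ _ (lt_of_le_of_lt (hsA i) (by norm_num)), btFMUL_and _ _ (lt_of_le_of_lt (hsB i) (by norm_num))]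
    have h1 := (bnd i).1
    unfold BIAS; omega

end Packed

/-! ### The profile lane function is the y-profile -/

/-- A sum over the table `tdList (enc y)` is a sum over the points totally distinct from `y`. [this work] -/
theorem tdList_sum_eq (y : Pd 4) (h : ℕ × ℕ → ℤ) (g : Pd 4 → ℤ) (hg : ∀ q : Pd 4, h (enc q, thirdC (enc q) (enc y)) = g q) :
    ((tdList (enc y)).map h).sum = ∑ q : Pd 4, if TotDist q y = true then g q else 0 := by
  unfold tdList
  rw [List.map_map, sum_map_filter_eq, sum_map_range_eq, ← sum_enc_eq_sum_range]
  refine Finset.sum_congr rfl fun q _ => ?_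
  simp only [Function.comp, tdC_enc, hg]

/-- A representing mask's `0/1` bit is the indicator. [this work] -/
theorem bt_enc {a : ℕ} {A : Finset (Pd 4)} (h : Rep a A) (p : Pd 4) : (bt a (enc p) : ℤ) = ind A p := by
  unfold bt bit01 ind
  rw [h p]
  by_cases hp : p ∈ A <;> simp [hp]

/-- **The profile lane function is `BIAS +` the y-profile.** [this work] -/
theorem profN_eq {fA fB : ℕ → ℕ} {i : ℕ} {A B : Finset (Pd 4)} (ha : Rep (fA i) A) (hb : Rep (fB i) B) (p : Pd 4) :
    (profN fA fB (enc p) i : ℤ) = BIAS + yProfile A B p := by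
  have hle := (profN_parts_le fA fB (enc p) i).1
  have hle' : bt (fB i) (enc p) * ((tdList (enc p)).map fun qt => bt (fA i) qt.1).sum +
      bt (fA i) (enc p) * ((tdList (enc p)).map fun qt => bt (fB i) qt.1).sum +
      ((tdList (enc p)).map fun qt => bt (fA i) qt.1 * bt (fB i) qt.1).sum ≤
      BIAS + bt (fA i) (enc p) * bt (fB i) (enc p) * 32 + ((tdList (enc p)).map fun qt => bt (fB i) qt.1 * bt (fA i) qt.2).sum := by
    unfold BIAS; omega
  unfold profN
  rw [Nat.cast_sub hle']
  push_cast
  simp only [List.map_map]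
  have e1 : ((tdList (enc p)).map (Nat.cast ∘ fun qt : ℕ × ℕ => bt (fA i) qt.1) : List ℤ).sum =
      ∑ q : Pd 4, if TotDist q p = true then ind A q else 0 :=
    tdList_sum_eq p _ _ fun q => by simp only [Function.comp, bt_enc ha]
  have e2 : ((tdList (enc p)).map (Nat.cast ∘ fun qt : ℕ × ℕ => bt (fB i) qt.1) : List ℤ).sum =
      ∑ q : Pd 4, if TotDist q p = true then ind B q else 0 :=
    tdList_sum_eq p _ _ fun q => by simp only [Function.comp, bt_enc hb]
  have e3 : ((tdList (enc p)).map (Nat.cast ∘ fun qt : ℕ × ℕ => bt (fA i) qt.1 * bt (fB i) qt.1) : List ℤ).sum =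
      ∑ q : Pd 4, if TotDist q p = true then ind A q * ind B q else 0 :=
    tdList_sum_eq p _ _ fun q => by simp only [Function.comp, Nat.cast_mul, bt_enc ha, bt_enc hb]
  have e4 : ((tdList (enc p)).map (Nat.cast ∘ fun qt : ℕ × ℕ => bt (fB i) qt.1 * bt (fA i) qt.2) : List ℤ).sum =
      ∑ q : Pd 4, if TotDist q p = true then ind B q * ind A (thirdPt q p) else 0 :=
    tdList_sum_eq p _ _ fun q => by simp only [Function.comp, Nat.cast_mul, thirdC_enc, bt_enc ha, bt_enc hb]
  rw [e1, e2, e3, e4, bt_enc ha, bt_enc hb, yProfile_eq, nuCount_eq_sum, sum_thetaVal_eq_sum]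
  -- both sides are now explicit; split the indicator sums
  have hsplit : ∑ q : Pd 4, (if TotDist q p = true then ind B q * (ind A q + ind A p - ind A (thirdPt q p)) else 0) =
      ∑ q : Pd 4, (if TotDist q p = true then ind A q * ind B q else 0) +
        ind A p * ∑ q : Pd 4, (if TotDist q p = true then ind B q else 0) -
        ∑ q : Pd 4, (if TotDist q p = true then ind B q * ind A (thirdPt q p) else 0) := by
    rw [Finset.mul_sum, ← Finset.sum_add_distrib, ← Finset.sum_sub_distrib]
    refine Finset.sum_congr rfl fun q _ => ?_
    by_cases ht : TotDist q p = true
    · simp only [ht, if_true]; ring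
    · simp only [ht]; simp
  rw [hsplit]
  have h32 : (2 : ℤ) * 2 ^ 4 = 32 := by norm_num
  rw [h32]
  unfold ind
  by_cases hpB : p ∈ B
  · simp only [hpB, if_true]; ring
  · simp only [hpB, if_false]; ring

end Summit.CriticalPhenomena.PercolationContinuityZ3.Theorems.SahiGridPattern.Pair43
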